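import Mathlib.Analysis.Convex.SpecificFunctions.Basic
import Literature.MathematicalPhysics.KineticTheory.HardSphereCanonicalClusterBound
import Literature.MathematicalPhysics.KineticTheory.HardSphereEulerLLN
import HarnessLib

/-!
# Ceiling statics: a Ruelle-factor Chernoff bound for the low-density canonical hard-sphere gas

Supporting file of the line `Sketch` for the crux `AprioriBounds` (stmt-AtomisticToContinuum-14827;
`Summit.AtomisticToContinuum.HydrodynamicLimit.Theses.StiffCollisionalRelaxation.AprioriBounds`), lead prover
`prover-line-stmt-AtomisticToContinuum-14827-c2-0`.  It serves the registered stub `stub_hotJam` (component (ii) of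
the crux: no mesoscopic cell is ever jammed) by delivering the STATIC INPUT of its equilibrium rung — the interface
`H-up` consumed by `ceilingFixed_homogeneous_of_static`: for the canonical gas of `N + 1` hard spheres of diameter
`ε_N = hsDiameter σ N` on `𝕋³` with uniform activity, `posGibbsMeasure 1 ε_N (N+1)`, at small reduced density
(`SmallDensity uniformProfile σ`), every additive positional observable `∑ᵢ g(xᵢ)` with measurable `0 ≤ g ≤ L` has
the Chernoff upper tail

  `P{(N+1) K ∫g < ∑ᵢ g(xᵢ)} ≤ exp(−((N+1)∫g/L) (K log(K/2) − K + 2))`,  `K > 2`,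

UNIFORMLY in the sup-bound `L` (`posGibbs_sum_gt_le`; quantifier form `ceiling_statics_hUp`, the sub-goal registered on the
crux item for this supporting file).

* §1 DROPPING CONSTRAINTS (`ruelleChernoff_integral_hardCore_mul_le`): for a bounded measurable `F ≥ 0` depending
  only on the labels in `B`, `∫ 𝟙[hardCore(univ)] F dℙ^{⊗} ≤ Ξ(univ ∖ B) ∫ F dℙ^{⊗}` (fewer constraints, then
  independence of disjoint blocks, `integral_mul_eq_of_dependsOn`) — the function form of
  `pi_hardCore_inter_le_of_dependsOn`.
* §2 THE RUELLE FACTOR `2` (`ruelleChernoff_integral_prod_one_add_le`): `E_G ∏ᵢ (1 + f(xᵢ)) ≤ (1 + 2∫f)^{N+1}` for a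
  bounded measurable `f ≥ 0` — expand over subsets (`Finset.prod_one_add`, all terms nonnegative), drop the
  constraints touching the subset at the price `Ξ(univ ∖ B)/Ξ(univ) = r_N(N+1, #B) ≤ 2^{#B}`
  (`hcProb_sdiff_mul_inv_eq_rN`, `SmallDensity.rN_le_two_pow`), integrate the now independent coordinates
  (`integral_fintype_prod_eq_prod`) and resum.
* §3 CHERNOFF (`posGibbs_sum_gt_le`): Markov for `∏ᵢ e^{t g(xᵢ)} = ∏ᵢ (1 + fᵢ)` with `f = e^{tg} − 1`,
  `t = log(K/2)/L`, and the convexity bound `e^{tg} − 1 ≤ (e^{tL} − 1) g/L = (K/2 − 1) g/L`.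

This is the Ruelle bound for the canonical correlation functions of a hard-core gas (Ruelle 1969, §4.2) in
generating-function form.  No new definitions, no named facts; axioms `propext`, `Classical.choice`, `Quot.sound`.
-/

noncomputable section

namespace Summit.AtomisticToContinuum.HydrodynamicLimit.Theorems.AdiabatCeiling

open MeasureTheory ProbabilityTheory Finset Filter Set Literature.MathematicalPhysics.KineticTheory
  Literature.MathematicalPhysics.StatisticalMechanics Literature.Analysis.FluidPDE
open scoped ENNReal

/-! ## §1 Dropping the hard-core constraints of a set of labels (function form) -/

/-- An indicator `𝟙_s ∈ {0, 1}` has absolute value at most one. -/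
private theorem ruelleChernoff_abs_indicator_one_le {α : Type*} (s : Set α) (x : α) :
    |s.indicator (1 : α → ℝ) x| ≤ 1 := by
  by_cases hx : x ∈ s
  · rw [Set.indicator_of_mem hx, Pi.one_apply, abs_one]
  · rw [Set.indicator_of_notMem hx, abs_zero]
    exact zero_le_one

/-- **Dropping constraints, function form**: for a bounded measurable `F ≥ 0` depending only on the labels in `B`,
`∫ 𝟙[hardCore(univ)] F dℙ^{⊗} ≤ Ξ(univ ∖ B) · ∫ F dℙ^{⊗}` — the hard-core set of all labels is contained in that
of `univ ∖ B`, whose indicator depends only on `univ ∖ B` and is therefore independent of `F`. -/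
theorem ruelleChernoff_integral_hardCore_mul_le (ε : ℝ) {n : ℕ} (B : Finset (Fin n)) {F : (Fin n → T3) → ℝ}
    (hFm : Measurable F) (hF0 : ∀ x, 0 ≤ F x) {C : ℝ} (hFC : ∀ x, F x ≤ C)
    (hdep : DependsOn F (B : Set (Fin n))) :
    ∫ x, (hardCoreSet (Ov ε) (univ : Finset (Fin n))).indicator (1 : (Fin n → T3) → ℝ) x * F x
        ∂Measure.pi (fun _ : Fin n => (volume : Measure T3))
      ≤ hcProb (Ov ε) (volume : Measure T3) ((univ : Finset (Fin n)) \ B) *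
          ∫ x, F x ∂Measure.pi (fun _ : Fin n => (volume : Measure T3)) := by
  classical
  have hHC : MeasurableSet (hardCoreSet (Ov ε) ((univ : Finset (Fin n)) \ B) : Set (Fin n → T3)) :=
    measurableSet_hardCoreSet (measurableSet_ov ε) _
  have hHCu : MeasurableSet (hardCoreSet (Ov ε) (univ : Finset (Fin n)) : Set (Fin n → T3)) :=
    measurableSet_hardCoreSet (measurableSet_ov ε) _
  have hsub : (hardCoreSet (Ov ε) (univ : Finset (Fin n)) : Set (Fin n → T3)) ⊆
      hardCoreSet (Ov ε) ((univ : Finset (Fin n)) \ B) :=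
    fun x hx a _ b _ hab => hx a (mem_univ a) b (mem_univ b) hab
  have hFm1 : Measurable fun x : Fin n → T3 =>
      (hardCoreSet (Ov ε) ((univ : Finset (Fin n)) \ B) : Set (Fin n → T3)).indicator
        (1 : (Fin n → T3) → ℝ) x :=
    measurable_one.indicator hHC
  have hFm0 : Measurable fun x : Fin n → T3 =>
      (hardCoreSet (Ov ε) (univ : Finset (Fin n)) : Set (Fin n → T3)).indicator (1 : (Fin n → T3) → ℝ) x :=
    measurable_one.indicator hHCu
  have hbd : ∀ (W : Finset (Fin n)) (x : Fin n → T3),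
      |(hardCoreSet (Ov ε) W : Set (Fin n → T3)).indicator (1 : (Fin n → T3) → ℝ) x * F x| ≤ 1 * C := by
    intro W x
    rw [abs_mul]
    exact mul_le_mul (ruelleChernoff_abs_indicator_one_le _ x) ((abs_of_nonneg (hF0 x)).trans_le (hFC x))
      (abs_nonneg _) zero_le_one
  have hint0 := integrable_pi_of_bounded (volume : Measure T3) (hFm0.fun_mul hFm) (hbd univ)
  have hint1 := integrable_pi_of_bounded (volume : Measure T3) (hFm1.fun_mul hFm) (hbd (univ \ B))
  have hdepW : DependsOn (fun x : Fin n → T3 =>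
      (hardCoreSet (Ov ε) ((univ : Finset (Fin n)) \ B) : Set (Fin n → T3)).indicator
        (1 : (Fin n → T3) → ℝ) x) ((((univ : Finset (Fin n)) \ B : Finset (Fin n))) : Set (Fin n)) := by
    refine dependsOn_indicator_of_mem_iff fun x y hxy => ?_
    simp only [hardCoreSet, Set.mem_setOf_eq]
    constructor
    · intro h a ha b hb hab; rw [← hxy a ha, ← hxy b hb]; exact h a ha b hb hab
    · intro h a ha b hb hab; rw [hxy a ha, hxy b hb]; exact h a ha b hb hab
  calc ∫ x, (hardCoreSet (Ov ε) (univ : Finset (Fin n))).indicator (1 : (Fin n → T3) → ℝ) x * F x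
          ∂Measure.pi (fun _ : Fin n => (volume : Measure T3))
      ≤ ∫ x, (hardCoreSet (Ov ε) ((univ : Finset (Fin n)) \ B) : Set (Fin n → T3)).indicator
            (1 : (Fin n → T3) → ℝ) x * F x ∂Measure.pi (fun _ : Fin n => (volume : Measure T3)) :=
        integral_mono hint0 hint1 fun x => mul_le_mul_of_nonneg_right
          (Set.indicator_le_indicator_of_subset hsub (fun _ => zero_le_one) x) (hF0 x)
    _ = (∫ x, (hardCoreSet (Ov ε) ((univ : Finset (Fin n)) \ B) : Set (Fin n → T3)).indicator
            (1 : (Fin n → T3) → ℝ) x ∂Measure.pi (fun _ : Fin n => (volume : Measure T3))) *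
          ∫ x, F x ∂Measure.pi (fun _ : Fin n => (volume : Measure T3)) :=
        integral_mul_eq_of_dependsOn (volume : Measure T3) sdiff_disjoint hFm1 hFm hdepW hdep
    _ = hcProb (Ov ε) (volume : Measure T3) ((univ : Finset (Fin n)) \ B) *
          ∫ x, F x ∂Measure.pi (fun _ : Fin n => (volume : Measure T3)) := by
        rw [integral_indicator_one hHC, hcProb]

/-! ## §2 The Ruelle factor `2`: `E_G ∏ᵢ (1 + f(xᵢ)) ≤ (1 + 2 ∫ f)^{N+1}` -/

/-- **Independent coordinates**: `∫ ∏_{i ∈ B} f(xᵢ) dℙ^{⊗} = (∫ f)^{#B}` (Haar measure on `𝕋³` is a probability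
measure, so the labels outside `B` contribute factors `1`). -/
theorem ruelleChernoff_integral_prod_eq_pow {n : ℕ} (B : Finset (Fin n)) (f : T3 → ℝ) :
    ∫ x, ∏ i ∈ B, f (x i) ∂Measure.pi (fun _ : Fin n => (volume : Measure T3)) = (∫ y, f y) ^ B.card := by
  classical
  have hfun : ∀ x : Fin n → T3, ∏ i ∈ B, f (x i) = ∏ i, (if i ∈ B then f (x i) else 1) := by
    intro x
    rw [Finset.prod_ite_mem, Finset.univ_inter]
  have hpi : ∫ x, ∏ i, (if i ∈ B then f (x i) else (1 : ℝ)) ∂Measure.pi (fun _ : Fin n => (volume : Measure T3))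
      = ∏ i : Fin n, ∫ y, (if i ∈ B then f y else (1 : ℝ)) ∂(volume : Measure T3) :=
    integral_fintype_prod_eq_prod (fun (i : Fin n) (y : T3) => if i ∈ B then f y else (1 : ℝ))
  have hint : ∀ i : Fin n, ∫ y, (if i ∈ B then f y else (1 : ℝ)) ∂(volume : Measure T3)
      = if i ∈ B then ∫ y, f y else 1 := by
    intro i
    split_ifs
    · rfl
    · simp
  simp_rw [hfun]
  rw [hpi]
  simp_rw [hint]
  rw [Finset.prod_ite_mem, Finset.univ_inter, Finset.prod_const]

/-- **Resummation**: `∑_{B ⊆ univ} 2^{#B} m^{#B} = (1 + 2m)^n` (`Finset.prod_one_add` backwards). -/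
theorem ruelleChernoff_sum_two_pow_mul_pow (n : ℕ) (m : ℝ) :
    ∑ B ∈ (univ : Finset (Fin n)).powerset, (2 : ℝ) ^ B.card * m ^ B.card = (1 + 2 * m) ^ n := by
  have h := Finset.prod_one_add (f := fun _ : Fin n => 2 * m) (univ : Finset (Fin n))
  simp only [Finset.prod_const, Finset.card_univ, Fintype.card_fin] at h
  rw [h]
  refine Finset.sum_congr rfl fun B _ => ?_
  rw [mul_pow]

/-- **The Ruelle factor `2`** (Ruelle 1969 §4.2, canonical hard-core gas at small density, generating-function
form): for a bounded measurable `f ≥ 0` on `𝕋³`,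
`∫ ∏ᵢ (1 + f(xᵢ)) d(posGibbsMeasure 1 ε_N (N+1)) ≤ (1 + 2 ∫ f)^{N+1}`.
Proof: `∏ᵢ (1 + f(xᵢ)) = ∑_B ∏_{i∈B} f(xᵢ)`; for each `B` drop the hard-core constraints touching `B`
(`ruelleChernoff_integral_hardCore_mul_le`), pay `Ξ(univ ∖ B)/Ξ(univ) = r_N(N+1, #B) ≤ 2^{#B}`, integrate the
independent coordinates and resum. -/
theorem ruelleChernoff_integral_prod_one_add_le {σ : ℝ} (hS : SmallDensity uniformProfile σ) (N : ℕ) {f : T3 → ℝ}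
    (hf : Measurable f) (hf0 : ∀ y, 0 ≤ f y) {C : ℝ} (hfC : ∀ y, f y ≤ C) :
    ∫ x, ∏ i, (1 + f (x i)) ∂posGibbsMeasure (fun _ => (1 : ℝ)) (hsDiameter σ N) (N + 1)
      ≤ (1 + 2 * ∫ y, f y) ^ (N + 1) := by
  classical
  have hHCu : MeasurableSet
      (hardCoreSet (Ov (hsDiameter σ N)) (univ : Finset (Fin (N + 1))) : Set (Fin (N + 1) → T3)) :=
    measurableSet_hardCoreSet (measurableSet_ov _) _
  -- the pieces `F_B(x) = ∏_{i ∈ B} f(xᵢ)`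
  have hFBm : ∀ B : Finset (Fin (N + 1)), Measurable fun x : Fin (N + 1) → T3 => ∏ i ∈ B, f (x i) :=
    fun B => Finset.measurable_prod _ fun i _ => hf.comp (measurable_pi_apply i)
  have hFB0 : ∀ (B : Finset (Fin (N + 1))) (x : Fin (N + 1) → T3), 0 ≤ ∏ i ∈ B, f (x i) :=
    fun B x => Finset.prod_nonneg fun i _ => hf0 _
  have hFBC : ∀ (B : Finset (Fin (N + 1))) (x : Fin (N + 1) → T3), ∏ i ∈ B, f (x i) ≤ C ^ B.card := by
    intro B x
    calc ∏ i ∈ B, f (x i) ≤ ∏ _i ∈ B, C := Finset.prod_le_prod (fun i _ => hf0 _) fun i _ => hfC _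
      _ = C ^ B.card := Finset.prod_const C
  have hFBdep : ∀ B : Finset (Fin (N + 1)),
      DependsOn (fun x : Fin (N + 1) → T3 => ∏ i ∈ B, f (x i)) (B : Set (Fin (N + 1))) := by
    intro B x y hxy
    exact Finset.prod_congr rfl fun i hi => by rw [hxy i hi]
  have hbd : ∀ (B : Finset (Fin (N + 1))) (x : Fin (N + 1) → T3),
      |(hardCoreSet (Ov (hsDiameter σ N)) (univ : Finset (Fin (N + 1))) : Set (Fin (N + 1) → T3)).indicator
          (1 : (Fin (N + 1) → T3) → ℝ) x * ∏ i ∈ B, f (x i)| ≤ 1 * C ^ B.card := by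
    intro B x
    rw [abs_mul]
    exact mul_le_mul (ruelleChernoff_abs_indicator_one_le _ x) ((abs_of_nonneg (hFB0 B x)).trans_le (hFBC B x))
      (abs_nonneg _) zero_le_one
  -- each piece: drop the constraints touching `B`, integrate the independent coordinates
  have hterm : ∀ B : Finset (Fin (N + 1)),
      ∫ x, (hardCoreSet (Ov (hsDiameter σ N)) (univ : Finset (Fin (N + 1))) : Set (Fin (N + 1) → T3)).indicator
            (1 : (Fin (N + 1) → T3) → ℝ) x * ∏ i ∈ B, f (x i)
          ∂Measure.pi (fun _ : Fin (N + 1) => (volume : Measure T3))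
        ≤ hcProb (Ov (hsDiameter σ N)) (volume : Measure T3) ((univ : Finset (Fin (N + 1))) \ B) *
            (∫ y, f y) ^ B.card := by
    intro B
    have h := ruelleChernoff_integral_hardCore_mul_le (hsDiameter σ N) B (hFBm B) (hFB0 B) (hFBC B) (hFBdep B)
    rwa [ruelleChernoff_integral_prod_eq_pow B f] at h
  have hBc : ∀ B : Finset (Fin (N + 1)), B.card ≤ N + 1 := fun B => by simpa using B.card_le_univ
  have hI0 : 0 ≤ ∫ y, f y := integral_nonneg hf0
  -- the expansion under the integral
  have hind : ∀ x : Fin (N + 1) → T3,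
      (hardCoreSet (Ov (hsDiameter σ N)) (univ : Finset (Fin (N + 1))) : Set (Fin (N + 1) → T3)).indicator
          (fun x : Fin (N + 1) → T3 => ∏ i, (1 + f (x i))) x
        = ∑ B ∈ (univ : Finset (Fin (N + 1))).powerset,
            (hardCoreSet (Ov (hsDiameter σ N)) (univ : Finset (Fin (N + 1))) : Set (Fin (N + 1) → T3)).indicator
              (1 : (Fin (N + 1) → T3) → ℝ) x * ∏ i ∈ B, f (x i) := by
    intro x
    rw [← Finset.mul_sum, ← Finset.prod_one_add]
    by_cases hx : x ∈ (hardCoreSet (Ov (hsDiameter σ N)) (univ : Finset (Fin (N + 1))) : Set (Fin (N + 1) → T3))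
    · simp only [Set.indicator_of_mem hx, Pi.one_apply, one_mul]
    · simp only [Set.indicator_of_notMem hx, zero_mul]
  rw [posGibbsMeasure_eq continuous_const (fun _ => one_pos) (hsDiameter σ N) (N + 1), integral_smul_measure,
    profileOf_one_μ, Xi, firstLabels_self, profileOf_one_μ,
    ENNReal.toReal_ofReal (inv_nonneg.2 (hcProb_nonneg (volume : Measure T3) _)), smul_eq_mul,
    ← integral_indicator hHCu]
  simp_rw [hind]
  rw [integral_finsetSum _ fun B _ =>
    integrable_pi_of_bounded (volume : Measure T3) ((measurable_one.indicator hHCu).fun_mul (hFBm B)) (hbd B)]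
  calc (hcProb (Ov (hsDiameter σ N)) (volume : Measure T3) (univ : Finset (Fin (N + 1))))⁻¹ *
        ∑ B ∈ (univ : Finset (Fin (N + 1))).powerset,
          ∫ x, (hardCoreSet (Ov (hsDiameter σ N)) (univ : Finset (Fin (N + 1))) : Set (Fin (N + 1) → T3)).indicator
              (1 : (Fin (N + 1) → T3) → ℝ) x * ∏ i ∈ B, f (x i)
            ∂Measure.pi (fun _ : Fin (N + 1) => (volume : Measure T3))
      ≤ (hcProb (Ov (hsDiameter σ N)) (volume : Measure T3) (univ : Finset (Fin (N + 1))))⁻¹ *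
          ∑ B ∈ (univ : Finset (Fin (N + 1))).powerset,
            hcProb (Ov (hsDiameter σ N)) (volume : Measure T3) ((univ : Finset (Fin (N + 1))) \ B) *
              (∫ y, f y) ^ B.card :=
        mul_le_mul_of_nonneg_left (Finset.sum_le_sum fun B _ => hterm B)
          (inv_nonneg.2 (hcProb_nonneg (volume : Measure T3) _))
    _ = ∑ B ∈ (univ : Finset (Fin (N + 1))).powerset,
          rN uniformProfile σ N (N + 1) B.card * (∫ y, f y) ^ B.card := by
        rw [Finset.mul_sum]
        refine Finset.sum_congr rfl fun B _ => ?_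
        rw [← hcProb_sdiff_mul_inv_eq_rN σ B]
        ring
    _ ≤ ∑ B ∈ (univ : Finset (Fin (N + 1))).powerset, (2 : ℝ) ^ B.card * (∫ y, f y) ^ B.card :=
        Finset.sum_le_sum fun B _ =>
          mul_le_mul_of_nonneg_right (hS.rN_le_two_pow le_rfl (hBc B)) (pow_nonneg hI0 _)
    _ = (1 + 2 * ∫ y, f y) ^ (N + 1) := ruelleChernoff_sum_two_pow_mul_pow (N + 1) _

/-! ## §3 The Chernoff bound -/

/-- Convexity of the exponential on `[0, a]`: `e^{u a} − 1 ≤ u (e^{a} − 1)` for `0 ≤ u ≤ 1`. -/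
theorem ruelleChernoff_exp_mul_sub_one_le {u : ℝ} (a : ℝ) (hu0 : 0 ≤ u) (hu1 : u ≤ 1) :
    Real.exp (u * a) - 1 ≤ u * (Real.exp a - 1) := by
  have h := convexOn_exp.2 (Set.mem_univ (0 : ℝ)) (Set.mem_univ a) (sub_nonneg.2 hu1) hu0 (sub_add_cancel 1 u)
  simp only [smul_eq_mul, mul_zero, zero_add, Real.exp_zero, mul_one] at h
  linarith

/-- **Ceiling statics — the Ruelle-factor Chernoff bound.** For the canonical gas of `N + 1` hard spheres of
diameter `ε_N = hsDiameter σ N` on `𝕋³` with uniform activity, at small reduced density, and a measurable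
`0 ≤ g ≤ L` (`L > 0`), for every `K > 2`:
`P{(N+1) K ∫g < ∑ᵢ g(xᵢ)} ≤ exp(−((N+1)∫g/L)(K log(K/2) − K + 2))`.
Proof: Markov for `∏ᵢ e^{t g(xᵢ)}`, `t = log(K/2)/L`, whose expectation is at most
`(1 + 2∫(e^{tg} − 1))^{N+1} ≤ (1 + (K − 2)∫g/L)^{N+1} ≤ e^{(N+1)(K−2)∫g/L}` by the Ruelle factor `2`
(`ruelleChernoff_integral_prod_one_add_le`) and convexity (`e^{tg} − 1 ≤ (K/2 − 1) g/L`). -/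
theorem posGibbs_sum_gt_le {σ : ℝ} (hS : SmallDensity uniformProfile σ) (N : ℕ) {g : T3 → ℝ}
    (hg : Measurable g) {L : ℝ} (hL : 0 < L) (hg0 : ∀ y, 0 ≤ g y) (hgL : ∀ y, g y ≤ L) {K : ℝ}
    (hK : 2 < K) :
    posGibbsMeasure (fun _ => (1 : ℝ)) (hsDiameter σ N) (N + 1)
        {x | ((N : ℝ) + 1) * K * (∫ y, g y) < ∑ i, g (x i)} ≤
      ENNReal.ofReal (Real.exp (-((((N : ℝ) + 1) * ∫ y, g y) / L * (K * Real.log (K / 2) - K + 2)))) := by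
  classical
  haveI := isProbabilityMeasure_posGibbsMeasure (a₀ := fun _ : T3 => (1 : ℝ)) continuous_const
    (fun _ => one_pos) hS.σ_lt_half.le N
  -- the Chernoff parameter `t = log(K/2)/L > 0`
  have hK2 : 1 < K / 2 := by linarith
  have hexpa : Real.exp (Real.log (K / 2)) = K / 2 := Real.exp_log (by linarith)
  obtain ⟨t, ht⟩ : ∃ t : ℝ, t = Real.log (K / 2) / L := ⟨_, rfl⟩
  have ht0 : 0 < t := by rw [ht]; exact div_pos (Real.log_pos hK2) hL
  have htL : Real.exp (t * L) = K / 2 := by rw [ht, div_mul_cancel₀ _ hL.ne', hexpa]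
  -- the observable `f = e^{t g} − 1 ∈ [0, K/2 − 1]`, `f ≤ (K/2 − 1) g / L` by convexity
  obtain ⟨f, hf⟩ : ∃ f : T3 → ℝ, ∀ y, f y = Real.exp (t * g y) - 1 := ⟨fun y => Real.exp (t * g y) - 1, fun _ => rfl⟩
  have hfm : Measurable f := by
    rw [show f = fun y => Real.exp (t * g y) - 1 from funext hf]
    exact (hg.const_mul t).exp.sub measurable_const
  have hf0 : ∀ y, 0 ≤ f y := fun y => by
    rw [hf]; exact sub_nonneg.2 (Real.one_le_exp (mul_nonneg ht0.le (hg0 y)))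
  have hfle : ∀ y, f y ≤ (K / 2 - 1) / L * g y := by
    intro y
    have h := ruelleChernoff_exp_mul_sub_one_le (t * L) (div_nonneg (hg0 y) hL.le) ((div_le_one hL).2 (hgL y))
    have hmul : g y / L * (t * L) = t * g y := by
      rw [div_mul_eq_mul_div, mul_left_comm, mul_div_assoc, mul_div_cancel_right₀ _ hL.ne']
    rw [htL, hmul] at h
    rw [hf]
    calc Real.exp (t * g y) - 1 ≤ g y / L * (K / 2 - 1) := h
      _ = (K / 2 - 1) / L * g y := by ring
  have hfC : ∀ y, f y ≤ K / 2 - 1 := fun y =>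
    (hfle y).trans ((mul_le_mul_of_nonneg_left (hgL y) (div_nonneg (by linarith) hL.le)).trans_eq
      (div_mul_cancel₀ _ hL.ne'))
  -- `∫ f ≤ (K/2 − 1)/L ∫ g`
  have hintf : Integrable f (volume : Measure T3) :=
    Integrable.of_bound hfm.aestronglyMeasurable (K / 2 - 1)
      (ae_of_all _ fun y => by rw [Real.norm_eq_abs, abs_of_nonneg (hf0 y)]; exact hfC y)
  have hintg : Integrable g (volume : Measure T3) :=
    Integrable.of_bound hg.aestronglyMeasurable L
      (ae_of_all _ fun y => by rw [Real.norm_eq_abs, abs_of_nonneg (hg0 y)]; exact hgL y)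
  have hIf : ∫ y, f y ≤ (K / 2 - 1) / L * ∫ y, g y := by
    calc ∫ y, f y ≤ ∫ y, (K / 2 - 1) / L * g y := integral_mono hintf (hintg.const_mul _) hfle
      _ = (K / 2 - 1) / L * ∫ y, g y := integral_const_mul _ _
  have hI0 : 0 ≤ ∫ y, f y := integral_nonneg hf0
  have hm0 : 0 ≤ ∫ y, g y := integral_nonneg hg0
  -- the Ruelle factor `2` for `f`, and `∏ᵢ (1 + f(xᵢ)) = e^{t ∑ g(xᵢ)}`
  have hprod := ruelleChernoff_integral_prod_one_add_le hS N hfm hf0 hfC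
  have hFexp : ∀ x : Fin (N + 1) → T3, ∏ i, (1 + f (x i)) = Real.exp (t * ∑ i, g (x i)) := by
    intro x
    rw [Finset.mul_sum, Real.exp_sum]
    refine Finset.prod_congr rfl fun i _ => ?_
    rw [hf]
    ring
  have hFm : Measurable fun x : Fin (N + 1) → T3 => ∏ i, (1 + f (x i)) :=
    Finset.measurable_prod _ fun i _ => (hfm.comp (measurable_pi_apply i)).const_add 1
  have hF0 : ∀ x : Fin (N + 1) → T3, 0 ≤ ∏ i, (1 + f (x i)) :=
    fun x => Finset.prod_nonneg fun i _ => add_nonneg zero_le_one (hf0 _)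
  have hFC : ∀ x : Fin (N + 1) → T3, ∏ i, (1 + f (x i)) ≤ (K / 2) ^ (N + 1) := by
    intro x
    calc ∏ i, (1 + f (x i)) ≤ ∏ _i : Fin (N + 1), (K / 2) :=
          Finset.prod_le_prod (fun i _ => add_nonneg zero_le_one (hf0 _)) fun i _ => by linarith [hfC (x i)]
      _ = (K / 2) ^ (N + 1) := by rw [Finset.prod_const, Finset.card_univ, Fintype.card_fin]
  have hintF : Integrable (fun x : Fin (N + 1) → T3 => ∏ i, (1 + f (x i)))
      (posGibbsMeasure (fun _ => (1 : ℝ)) (hsDiameter σ N) (N + 1)) :=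
    Integrable.of_bound hFm.aestronglyMeasurable ((K / 2) ^ (N + 1))
      (ae_of_all _ fun x => by rw [Real.norm_eq_abs, abs_of_nonneg (hF0 x)]; exact hFC x)
  -- Markov
  have hsub : {x : Fin (N + 1) → T3 | ((N : ℝ) + 1) * K * (∫ y, g y) < ∑ i, g (x i)} ⊆
      {x | ENNReal.ofReal (Real.exp (t * (((N : ℝ) + 1) * K * ∫ y, g y))) ≤
        ENNReal.ofReal (∏ i, (1 + f (x i)))} := by
    intro x hx
    rw [Set.mem_setOf_eq] at hx ⊢
    rw [hFexp]
    exact ENNReal.ofReal_le_ofReal (Real.exp_le_exp.2 (mul_le_mul_of_nonneg_left hx.le ht0.le))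
  refine (measure_mono hsub).trans ?_
  refine (meas_ge_le_lintegral_div hFm.ennreal_ofReal.aemeasurable
    (ENNReal.ofReal_pos.2 (Real.exp_pos _)).ne' ENNReal.ofReal_ne_top).trans ?_
  rw [← ofReal_integral_eq_lintegral_ofReal hintF (ae_of_all _ hF0), ← ENNReal.ofReal_div_of_pos (Real.exp_pos _)]
  refine ENNReal.ofReal_le_ofReal ?_
  rw [div_le_iff₀ (Real.exp_pos _), ← Real.exp_add]
  -- the real inequality
  have h2 : 2 * ((K / 2 - 1) / L * ∫ y, g y) = (K - 2) / L * ∫ y, g y := by ring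
  calc ∫ x, ∏ i, (1 + f (x i)) ∂posGibbsMeasure (fun _ => (1 : ℝ)) (hsDiameter σ N) (N + 1)
      ≤ (1 + 2 * ∫ y, f y) ^ (N + 1) := hprod
    _ ≤ (1 + (K - 2) / L * ∫ y, g y) ^ (N + 1) := pow_le_pow_left₀ (by linarith) (by linarith) _
    _ ≤ Real.exp ((K - 2) / L * ∫ y, g y) ^ (N + 1) :=
        pow_le_pow_left₀ (add_nonneg zero_le_one (mul_nonneg (div_nonneg (by linarith) hL.le) hm0))
          (by linarith [Real.add_one_le_exp ((K - 2) / L * ∫ y, g y)]) _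
    _ = Real.exp ((N + 1 : ℕ) * ((K - 2) / L * ∫ y, g y)) := (Real.exp_nat_mul _ _).symm
    _ = Real.exp (-((((N : ℝ) + 1) * ∫ y, g y) / L * (K * Real.log (K / 2) - K + 2)) +
          t * (((N : ℝ) + 1) * K * ∫ y, g y)) := by
        congr 1
        rw [ht]
        push_cast
        ring

/-- **Ceiling statics, quantifier form** — the interface `H-up` of the lead's wave (registered sub-goal
`ceiling_statics_hUp` of `stub_hotJam`'s equilibrium rung, consumed by `ceilingFixed_homogeneous_of_static`): for every
`σ` with `SmallDensity uniformProfile σ`, every `N`, every measurable `0 ≤ g ≤ L` (`L > 0`) and every `K > 2`,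
`posGibbsMeasure 1 ε_N (N+1) {(N+1) K ∫g < ∑ᵢ g(xᵢ)} ≤ exp(−((N+1)∫g/L)(K log(K/2) − K + 2))`
(`posGibbs_sum_gt_le`). -/
theorem ceiling_statics_hUp :
    ∀ (σ : ℝ), SmallDensity uniformProfile σ → ∀ (N : ℕ) (g : T3 → ℝ), Measurable g → ∀ (L : ℝ), 0 < L →
      (∀ y, 0 ≤ g y) → (∀ y, g y ≤ L) → ∀ (K : ℝ), 2 < K →
        posGibbsMeasure (fun _ => (1 : ℝ)) (hsDiameter σ N) (N + 1)
            {x | ((N : ℝ) + 1) * K * (∫ y, g y) < ∑ i, g (x i)} ≤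
          ENNReal.ofReal (Real.exp (-((((N : ℝ) + 1) * ∫ y, g y) / L * (K * Real.log (K / 2) - K + 2)))) :=
  fun _ hS N _ hg _ hL hg0 hgL _ hK => posGibbs_sum_gt_le hS N hg hL hg0 hgL hK

end Summit.AtomisticToContinuum.HydrodynamicLimit.Theorems.AdiabatCeiling

end
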